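import Summits.HodgeConjecture.HodgeConjecture.Theorems.F0P5LemD14IfFrameInvariance
import Literature.NumberTheory.Automorphic.Liu2021.LemD1Item4AtV2NonsplitEpsOfIsotropic
import Literature.NumberTheory.Automorphic.Liu2021.LemD1RankTwoCMSameLabelLetter
import Literature.NumberTheory.Automorphic.Liu2021.LemD1SplitPlaceOfFacts
import HarnessLib

/-!
# LD letter «R₂» (★ `LemD1RankTwoCMLetters.LemD1_4SameLabelNonsplitCM₂`, [Liu2021, Lem. D.1 (4)] same-label «only if») AT THE ISOTROPIC NON-SPLIT PLACES —
# PROVED in the letter's own binders, for EVERY pair enumeration `e₁`, with NO weight-one and NO non-vanishing hypothesis (theorems only)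

Cell `hodgecm-mathlib` (D-0151), FLOOR 0, half A line LD1 (socket `stub_S1_facts`, books row #73; the letter R₂ is shared with line LD2, #74R), seat LD1-p01 (g2),
2026-09-02.  THEOREMS ONLY (no `def`, no named fact, no instance, no `sorry`); `--supports stmt-HodgeConjecture-24832`.  Summits-side because the frame
invariance ★ (E) `F0P5LemD14IfFrameInvariance.areIsomorphicRep_theta_cmPackage_of_equiv` it composes is a Summits-side theorem.

THE POINT.  The booked letter R₂ (★ p849678) says: for the rank-2 CM θ-packages `(λ, a, χ)`, `(λ, a′, χ)` at a finite place `v` of `L⁺` NON-SPLIT in `L`,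
«`Θ_v(λ, a′, χ) ≠ 0` and `Θ_v(λ, a, χ) ≅ Θ_v(λ, a′, χ)` ⟹ `locF a v = locF a′ v`».  At the places `v` where the hermitian plane `(L_v², diag dV)` is ISOTROPIC — all
but the finitely many `v` with `(δ², −dV₀dV₁)_v = −1` (★ `LemD1OfPlace.not_isIsotropic_standingData_iff_hilbertSymbol_eq_neg_one`, ★ `finite_setOf_not_isIsotropic`) — this
is now a THEOREM of the tree, and in a stronger form: **`locF_apply_eq_of_equiv_localTypes_nonsplit_of_isIsotropic`** — R₂'s binders verbatim (any CM `L`, real non-zero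
frame `dV`, ANY enumeration `e₁ : Fin 2 × Fin 1 ≃ Fin n′`, conjugate-symplectic `λ`, lines `a, a′`, centre character `χ`, non-split `v`) MINUS the weight-one binder and
MINUS the non-vanishing hypothesis, PLUS «`(L_v², diag dV)` is isotropic», conclusion R₂'s.  Chain (all links ★, BY NAME):
* ★ (E) `areIsomorphicRep_theta_cmPackage_of_equiv` (A-p12∕A-p18, L4-if road): the θ-package local factor of the letter's package does not depend on the
  enumeration — `Θ_{e₁}(λ, b) ≅ Θ_{pU}(λ, b)` for `b = a, a′`, `pU := Equiv.prodUnique (Fin 2) (Fin 1)`;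
* ★ `sameClass_and_chi_eq_of_areIsomorphicRep_localType₂_nonsplit_of_isIsotropic` (LD1-p01 (g2), p849937; `Liu2021/LemD1Item4AtV2NonsplitEpsOfIsotropic.lean` §4) on
  the two-member family `0 ↦ (λ, a, χ)`, `1 ↦ (λ, a′, χ)` at `pU`: at an isotropic non-split place `Θ_v(0) ≅ Θ_v(1)` forces the Step-1 representatives
  `(aδ) ⊗ 1`, `(a′δ) ⊗ 1` into one class — through the splitting-free disjointness of rank-one theta lifts ★ `rankOne_theta_lines_disjoint_of_isotropic`
  (p849893; the cell's anisotropic-doubling ∕ root-subgroup engine ★ `rankOne_theta_lines_disjoint_holds` with the isotropic vector supplied) and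
  [MoeglinVignerasWaldspurger1987, IV.2] PROVED (no theta lift vanishes at an isotropic `V`, whence no non-vanishing hypothesis);
* ★ `locF_apply_eq_of_sameClass_epsLine`: same class of the representatives ⟺ `locF a v = locF a′ v`.
`L_v` is a field at a non-split `v` by the contrapositive of ★ `SplitPlace.exists_placesOver_smul_ne_of_not_isField` (B-p04's idiom).

WHAT IT PAYS (numbers, not adjectives).  R₂ is one of the FOUR shared printed letter stubs of both LD leaves after the «T2 swap» ({(A₂-P), (B6), (I′), R₂}); this file
settles R₂ at every isotropic non-split place in-house, so an R₂ payer is left with EXACTLY the finitely many ANISOTROPIC non-split places (the (P)∕(T3′) «pin» road of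
the LD bus, 2026-09-02) — where the splitting-free statement is false ([Liu2021, Lem. D.1 (4)]: `ω(μᶜχ̌, ε′, χ) ≅ ω(μ, ε, χ)` with `ε′ ≁ ε`) and the matched splittings
must be used.  Consumer shape for that payer: `by_cases hV : LemD1.IsIsotropic (…standingData…)` → this theorem ∕ the anisotropic organ.

HONEST LABEL.  Nothing of [Liu2021] is asserted; no book row moves by this file alone (R₂ stays booked until its anisotropic half lands); HC_CM is proved only modulo the
7 printed citations (2 remaining: hLiu418 = stmt-HodgeConjecture-24832, h413 = stmt-HodgeConjecture-24833) until rung 0 closes; count-neutral.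

## References
* [Liu2021] Y. Liu, *Fourier–Jacobi cycles and arithmetic relative trace formula*, Camb. J. Math. 9 (2021) = arXiv:2102.11518 — App. D Lem. D.1 (4) (p. 126,
  TeX l. 5235) and its proof (l. 5257–5262); §D.1 Steps 1–3 (l. 5213–5224); Def. 4.12.
* [MoeglinVignerasWaldspurger1987] C. Mœglin, M.-F. Vignéras, J.-L. Waldspurger, LNM 1291 (1987), Chap. 2 II Remarque (3), Chap. 3 IV.2, IV.4.
* [HarrisKudlaSweet1996] M. Harris, S. Kudla, W. J. Sweet, J. AMS 9 (1996), Cor. 4.4, Thm. 6.1.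
-/

set_option autoImplicit false
set_option linter.dupNamespace false

noncomputable section

open scoped Matrix Kronecker RestrictedProduct NumberField TensorProduct
open NumberField IsDedekindDomain Filter
open Literature.NumberTheory Literature.NumberTheory.Automorphic Literature.NumberTheory.Automorphic.UnitaryGroup
open Literature.NumberTheory.GelbartRogawski1991 Literature.NumberTheory.GelbartRogawski1991.UnitaryDualPair
open Literature.NumberTheory.GelbartRogawski1991.UnitaryDualPair.WeilCoinv
open Literature.NumberTheory.GelbartRogawski1991.UnitaryDualPair.LocalSplitting
open Literature.NumberTheory.GelbartRogawski1991.GRConstruction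
open Literature.NumberTheory.Weil1964 Literature.RepresentationTheory
open Literature.RepresentationTheory.HeisenbergGroup
open Literature.NumberTheory.GaloisRepresentations Literature.RepresentationTheory.HarrisKudlaSweet1996
open Literature.NumberTheory.Automorphic.IdeleClassGroup Literature.RepresentationTheory.Liu2021
open Literature.NumberTheory.Automorphic.Liu2021 Literature.NumberTheory.Automorphic.Liu2021.Def411WeilCarriers
open Literature.NumberTheory.Automorphic.Liu2021.Def411WeilCarriersDoubling
open Literature.NumberTheory.Automorphic.Liu2021.LemD1RankTwoCMLetters
open Summit.HodgeConjecture.HodgeConjecture.Cruxes.HLiu418.F0P5LemD14IfFrameInvariance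

namespace Summit.HodgeConjecture.HodgeConjecture.Cruxes.HLiu418.F0LD1SameLabelRigidityOfIsotropic

set_option synthInstance.maxHeartbeats 400000 in
set_option maxHeartbeats 4000000 in -- the CM θ-package terms of the letter's binders (cf. ★ E₂ `locF_apply_eq_of_equiv_localTypes_nonsplit'`, 3.2 M)
/-- **THE LETTER «R₂» AT AN ISOTROPIC NON-SPLIT PLACE — PROVED, every enumeration `e₁`, no weight-one, no non-vanishing hypothesis.**  For a CM field `L`
(`L⁺ = maximalRealSubfield L`, `c` = complex conjugation, `δ = imagUnit L`), a real non-zero frame `dV : Fin 2 → L`, ANY reindexing `e₁ : Fin 2 × Fin 1 ≃ Fin n′`, a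
conjugate-symplectic idèle class character `λ`, lines `a, a′ ∈ (L⁺)ˣ`, a centre character `χ`, and a finite place `v` of `L⁺` NON-SPLIT in `L` at which the hermitian plane
`(L_v², diag dV)` is ISOTROPIC: if the local θ-types satisfy `Θ_v(λ, a, χ) ≅ Θ_v(λ, a′, χ)` (`Representation.Equiv`, the tokens of ★ `LemD1_4SameLabelNonsplitCM₂` verbatim),
then `locF L⁺ (imagUnitSq L) a v = locF L⁺ (imagUnitSq L) a′ v` — the lines have the same local norm class at `v`.  Proof: ★ (E) moves both packages to the enumeration
`Equiv.prodUnique (Fin 2) (Fin 1)`; ★ `sameClass_and_chi_eq_of_areIsomorphicRep_localType₂_nonsplit_of_isIsotropic` (splitting-free disjointness of the rank-one theta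
lifts from two lines of different classes at an isotropic `V`, ★ `rankOne_theta_lines_disjoint_of_isotropic`, + MVW IV.2) on the family `0 ↦ a`, `1 ↦ a′`; ★
`locF_apply_eq_of_sameClass_epsLine`.  This is [Liu2021, Lem. D.1 (4)] «only if», same label, `ε`-clause, at an isotropic plane; the anisotropic places are NOT claimed.
[cite: Liu2021, App. D Lemma D.1 (4) (p. 126, l. 5235), proof l. 5257–5262; Def. 4.12] [cite: MoeglinVignerasWaldspurger1987, Chap. 3 IV.2, IV.4]
[cite: HarrisKudlaSweet1996, Cor. 4.4 p. 962] -/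
theorem locF_apply_eq_of_equiv_localTypes_nonsplit_of_isIsotropic
    (L : Type) [Field L] [NumberField L] [IsCMField L]
    (dV : Fin 2 → L) (hdV : ∀ i, IsCMField.complexConj L (dV i) = dV i) (hdV0 : ∀ i, dV i ≠ 0)
    {n' : ℕ} (e₁ : Fin 2 × Fin 1 ≃ Fin n')
    (lam : Literature.NumberTheory.Automorphic.IdeleClassGroup L →ₜ* Circle) (hlam : IsConjugateSymplectic L lam)
    (a a' : (↥(maximalRealSubfield L))ˣ) (χ : Chi (↥(maximalRealSubfield L)) L (IsCMField.complexConj L))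
    (v : HeightOneSpectrum (𝓞 (↥(maximalRealSubfield L))))
    (hns : ∀ w : UnitaryGroup.PlacesOver L v, IsCMField.complexConj L • (w : HeightOneSpectrum (𝓞 L)) = w)
    (hV : LemD1.IsIsotropic (LemD1OfPlace.standingData L v (IsCMField.complexConj L) 2 (Matrix.diagonal dV) (complexConj_imagUnit L)
      (imagUnit_ne_zero L) le_rfl
      (transpose_map_conj_JV (Fp L) L (IsCMField.complexConj L) 2 (Matrix.diagonal dV) (realDiagonal_isSymm L dV hdV) (realDiagonal_map L dV hdV).symm)
      (det_JV_ne_zero (Fp L) L 2 (Matrix.diagonal dV) (isUnit_det_realDiagonal L dV hdV hdV0) (realDiagonal_map L dV hdV).symm)))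
    (hiso :
      Nonempty ((show Representation ℂ (localPi L (IsCMField.complexConj L) 2 (Matrix.diagonal dV) v) _ from (TwistedCoinv.rep (localCharOfCenter (Fp L) L (IsCMField.complexConj L) (JW (Fp L) L a) (JW_apply_ne_zero (Fp L) L a) χ.1 v) (((congrW L e₁ dV hdV (lineW L (TW (Fp L) a)) (complexConj_lineW L (TW (Fp L) a)) (realDiagonal_lineW L (TW (Fp L) a)) (diagonal_lineW L (TW (Fp L) a) (JW_eq (Fp L) L a)) (undoubledSplittings L e₁ dV hdV hdV0 (lineW L (TW (Fp L) a)) (complexConj_lineW L (TW (Fp L) a)) (lineW_ne_zero L (TW (Fp L) a) (isUnit_det_TW (Fp L) a)) (toHeckeCharacter L lam) (borelPlaceMeasure L) (cmFinLocalFamily L e₁ dV hdV hdV0 (lineW L (TW (Fp L) a)) (complexConj_lineW L (TW (Fp L) a)) (lineW_ne_zero L (TW (Fp L) a) (isUnit_det_TW (Fp L) a)) (toHeckeCharacter L lam) ((isOscillatorChar_toHeckeCharacter_iff lam).mpr hlam) (borelPlaceMeasure L))) (isSymm_TW (Fp L) a) (JW_eq (Fp L) L a))).omegaLoc v) (commute_omegaLoc_localCenter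 (Fp L) L (IsCMField.complexConj L) 2 e₁ (Matrix.diagonal dV) (JW (Fp L) L a) (complexConj_imagUnit L) (imagUnit_ne_zero L) (imagUnit_mul_self L) (realDiagonal_isSymm L dV hdV) (isSymm_TW (Fp L) a) (realDiagonal_map L dV hdV).symm (JW_eq (Fp L) L a) (JW_apply_ne_zero (Fp L) L a) (congrW L e₁ dV hdV (lineW L (TW (Fp L) a)) (complexConj_lineW L (TW (Fp L) a)) (realDiagonal_lineW L (TW (Fp L) a)) (diagonal_lineW L (TW (Fp L) a) (JW_eq (Fp L) L a)) (undoubledSplittings L e₁ dV hdV hdV0 (lineW L (TW (Fp L) a)) (complexConj_lineW L (TW (Fp L) a)) (lineW_ne_zero L (TW (Fp L) a) (isUnit_det_TW (Fp L) a)) (toHeckeCharacter L lam) (borelPlaceMeasure L) (cmFinLocalFamily L e₁ dV hdV hdV0 (lineW L (TW (Fp L) a)) (complexConj_lineW L (TW (Fp L) a)) (lineW_ne_zero L (TW (Fp L) a) (isUnit_det_TW (Fp L) a)) (toHeckeCharacter L lam) ((isOscillatorChar_toHeckeCharacter_iff lam).mpr hlam) (borelPlaceMeasure L))) (isSymm_TW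 (Fp L) a) (JW_eq (Fp L) L a)) v)).comp (localLineInl L (IsCMField.complexConj L) 2 e₁ (Matrix.diagonal dV) (JW (Fp L) L a) v)).Equiv
        (show Representation ℂ (localPi L (IsCMField.complexConj L) 2 (Matrix.diagonal dV) v) _ from (TwistedCoinv.rep (localCharOfCenter (Fp L) L (IsCMField.complexConj L) (JW (Fp L) L a') (JW_apply_ne_zero (Fp L) L a') χ.1 v) (((congrW L e₁ dV hdV (lineW L (TW (Fp L) a')) (complexConj_lineW L (TW (Fp L) a')) (realDiagonal_lineW L (TW (Fp L) a')) (diagonal_lineW L (TW (Fp L) a') (JW_eq (Fp L) L a')) (undoubledSplittings L e₁ dV hdV hdV0 (lineW L (TW (Fp L) a')) (complexConj_lineW L (TW (Fp L) a')) (lineW_ne_zero L (TW (Fp L) a') (isUnit_det_TW (Fp L) a')) (toHeckeCharacter L lam) (borelPlaceMeasure L) (cmFinLocalFamily L e₁ dV hdV hdV0 (lineW L (TW (Fp L) a')) (complexConj_lineW L (TW (Fp L) a')) (lineW_ne_zero L (TW (Fp L) a') (isUnit_det_TW (Fp L) a')) (toHeckeCharacter L lam) ((isOscillatorChar_toHeckeCharacter_iff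 lam).mpr hlam) (borelPlaceMeasure L))) (isSymm_TW (Fp L) a') (JW_eq (Fp L) L a'))).omegaLoc v) (commute_omegaLoc_localCenter (Fp L) L (IsCMField.complexConj L) 2 e₁ (Matrix.diagonal dV) (JW (Fp L) L a') (complexConj_imagUnit L) (imagUnit_ne_zero L) (imagUnit_mul_self L) (realDiagonal_isSymm L dV hdV) (isSymm_TW (Fp L) a') (realDiagonal_map L dV hdV).symm (JW_eq (Fp L) L a') (JW_apply_ne_zero (Fp L) L a') (congrW L e₁ dV hdV (lineW L (TW (Fp L) a')) (complexConj_lineW L (TW (Fp L) a')) (realDiagonal_lineW L (TW (Fp L) a')) (diagonal_lineW L (TW (Fp L) a') (JW_eq (Fp L) L a')) (undoubledSplittings L e₁ dV hdV hdV0 (lineW L (TW (Fp L) a')) (complexConj_lineW L (TW (Fp L) a')) (lineW_ne_zero L (TW (Fp L) a') (isUnit_det_TW (Fp L) a')) (toHeckeCharacter L lam) (borelPlaceMeasure L) (cmFinLocalFamily L e₁ dV hdV hdV0 (lineW L (TW (Fp L) a')) (complexConj_lineW L (TW (Fp L) a')) (lineW_ne_zero L (TW (Fp L) a') (isUnit_det_TW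 (Fp L) a')) (toHeckeCharacter L lam) ((isOscillatorChar_toHeckeCharacter_iff lam).mpr hlam) (borelPlaceMeasure L))) (isSymm_TW (Fp L) a') (JW_eq (Fp L) L a')) v)).comp (localLineInl L (IsCMField.complexConj L) 2 e₁ (Matrix.diagonal dV) (JW (Fp L) L a') v)))
      ) :
    locF (↥(maximalRealSubfield L)) (imagUnitSq L) a v = locF (↥(maximalRealSubfield L)) (imagUnitSq L) a' v := by
  -- `L_v` is a field at the non-split place `v`
  have hE : IsField (LocalRing L v) := by
    by_contra h
    obtain ⟨w, hw⟩ := SplitPlace.exists_placesOver_smul_ne_of_not_isField L v (IsCMField.complexConj L)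
      (UnitaryGroup.algEquiv_ne_one_of_apply_eq_neg (Fp L) L (IsCMField.complexConj L) (complexConj_imagUnit L) (imagUnit_ne_zero L)) h
    exact hw (hns w)
  -- `n′ = 2` (so that `e₁` and `Equiv.prodUnique (Fin 2) (Fin 1)` are enumerations of the same `Fin 2`)
  have hn' : n' = 2 := by
    have h := Fintype.card_congr e₁
    simp only [Fintype.card_prod, Fintype.card_fin, mul_one] at h
    omega
  subst hn'
  -- ★ (E): the enumeration `e₁` ↦ `Equiv.prodUnique (Fin 2) (Fin 1)` on both packages
  have ha := areIsomorphicRep_theta_cmPackage_of_equiv L v dV hdV hdV0 (Equiv.prodUnique (Fin 2) (Fin 1)) e₁ (toHeckeCharacter L lam)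
    ((isOscillatorChar_toHeckeCharacter_iff lam).mpr hlam) a
    (localCharOfCenter (Fp L) L (IsCMField.complexConj L) (JW (Fp L) L a) (JW_apply_ne_zero (Fp L) L a) χ.1 v)
  have ha' := areIsomorphicRep_theta_cmPackage_of_equiv L v dV hdV hdV0 e₁ (Equiv.prodUnique (Fin 2) (Fin 1)) (toHeckeCharacter L lam)
    ((isOscillatorChar_toHeckeCharacter_iff lam).mpr hlam) a'
    (localCharOfCenter (Fp L) L (IsCMField.complexConj L) (JW (Fp L) L a') (JW_apply_ne_zero (Fp L) L a') χ.1 v)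
  have hisoPU := (ha.trans (hiso.elim fun E => areIsomorphicRep_of_equiv E)).trans ha'
  -- the splitting-free `(ε, χ)`-clauses at an isotropic place, on the family `0 ↦ a`, `1 ↦ a′` at `Equiv.prodUnique`
  have key := sameClass_and_chi_eq_of_areIsomorphicRep_localType₂_nonsplit_of_isIsotropic (Fp L) L (IsCMField.complexConj L) 2
    (Matrix.diagonal dV) (complexConj_imagUnit L) (imagUnit_ne_zero L) (imagUnit_mul_self L) (realDiagonal_isSymm L dV hdV)
    (isUnit_det_realDiagonal L dV hdV hdV0) (realDiagonal_map L dV hdV).symm le_rfl ![a, a'] (fun _ => χ)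
    (Fin.cons (α := fun i : Fin 2 => LocalSplitting.FinLocalSplittings (Fp L) L (IsCMField.complexConj L) 2 (complexConj_imagUnit L)
      (imagUnit_ne_zero L) (imagUnit_mul_self L) (gram (Fp L) (Equiv.prodUnique (Fin 2) (Fin 1)) (realDiagonal L dV hdV) (TW (Fp L) (![a, a'] i)))
      (isSymm_gram (Fp L) (Equiv.prodUnique (Fin 2) (Fin 1)) (realDiagonal_isSymm L dV hdV) (isSymm_TW (Fp L) (![a, a'] i)))
      (reindex_kronecker_eq_gram_map (Fp L) L (Equiv.prodUnique (Fin 2) (Fin 1)) (realDiagonal_map L dV hdV).symm (JW_eq (Fp L) L (![a, a'] i))))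
      (congrW L (Equiv.prodUnique (Fin 2) (Fin 1)) dV hdV (lineW L (TW (Fp L) a)) (complexConj_lineW L (TW (Fp L) a)) (realDiagonal_lineW L (TW (Fp L) a)) (diagonal_lineW L (TW (Fp L) a) (JW_eq (Fp L) L a)) (undoubledSplittings L (Equiv.prodUnique (Fin 2) (Fin 1)) dV hdV hdV0 (lineW L (TW (Fp L) a)) (complexConj_lineW L (TW (Fp L) a)) (lineW_ne_zero L (TW (Fp L) a) (isUnit_det_TW (Fp L) a)) (toHeckeCharacter L lam) (borelPlaceMeasure L) (cmFinLocalFamily L (Equiv.prodUnique (Fin 2) (Fin 1)) dV hdV hdV0 (lineW L (TW (Fp L) a)) (complexConj_lineW L (TW (Fp L) a)) (lineW_ne_zero L (TW (Fp L) a) (isUnit_det_TW (Fp L) a)) (toHeckeCharacter L lam) ((isOscillatorChar_toHeckeCharacter_iff lam).mpr hlam) (borelPlaceMeasure L))) (isSymm_TW (Fp L) a) (JW_eq (Fp L) L a)) (Fin.cons (congrW L (Equiv.prodUnique (Fin 2) (Fin 1)) dV hdV (lineW L (TW (Fp L) a')) (complexConj_lineW L (TW (Fp L) a')) (realDiagonal_lineW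 L (TW (Fp L) a')) (diagonal_lineW L (TW (Fp L) a') (JW_eq (Fp L) L a')) (undoubledSplittings L (Equiv.prodUnique (Fin 2) (Fin 1)) dV hdV hdV0 (lineW L (TW (Fp L) a')) (complexConj_lineW L (TW (Fp L) a')) (lineW_ne_zero L (TW (Fp L) a') (isUnit_det_TW (Fp L) a')) (toHeckeCharacter L lam) (borelPlaceMeasure L) (cmFinLocalFamily L (Equiv.prodUnique (Fin 2) (Fin 1)) dV hdV hdV0 (lineW L (TW (Fp L) a')) (complexConj_lineW L (TW (Fp L) a')) (lineW_ne_zero L (TW (Fp L) a') (isUnit_det_TW (Fp L) a')) (toHeckeCharacter L lam) ((isOscillatorChar_toHeckeCharacter_iff lam).mpr hlam) (borelPlaceMeasure L))) (isSymm_TW (Fp L) a') (JW_eq (Fp L) L a')) finZeroElim))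
    (fun _ => localMu L (toHeckeCharacter L lam)) (fun _ v x => norm_localMu L (toHeckeCharacter L lam) v (isUnitary_toHeckeCharacter L lam) x)
    (fun _ => continuous_localMu L (toHeckeCharacter L lam))
    (fun _ v t => localMu_toLocalRing_eq_one_iff L (toHeckeCharacter L lam) v ((isOscillatorChar_toHeckeCharacter_iff lam).mpr hlam) t)
    v hE hV 1 0 hisoPU
  -- same class of the Step-1 representatives `(a′δ) ⊗ 1 ~ (aδ) ⊗ 1` ⟹ same local norm class
  exact (locF_apply_eq_of_sameClass_epsLine (Fp L) L (IsCMField.complexConj L) 2 (Matrix.diagonal dV) (complexConj_imagUnit L) (imagUnit_ne_zero L)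
    (imagUnit_mul_self L) le_rfl _ _ v a' a key.1).symm

end Summit.HodgeConjecture.HodgeConjecture.Cruxes.HLiu418.F0LD1SameLabelRigidityOfIsotropic

end
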